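import Mathlib.RepresentationTheory.Basic
import Mathlib.LinearAlgebra.FiniteDimensional.Lemmas
import HarnessLib

/-!
# The dihedral fixed-space lemma (cell `hodge-kum4`, seat p2; kernel lemma for the atom (H3))

HONEST FRAMING.  Pure linear algebra; nothing about `K⁴(A)`, (H3) or the Hodge conjecture is proved
in this file.  It is the kernel half of seat p2's "Route A" to the atom
`Summit.Ventures.HodgeKum4.Kum4FixedFourfoldHasFixedPointAtKummer` (item stmt-Ventures-19595): at the
unique `⟨g, ι₀⟩ ≅ D₅`-fixed point `s*` of `K⁴(A)` the tangent representation `T = T_{s*}K` has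
`T^g = 0` (the `125` fixed points of `g` are reduced, Oguiso 2020) and `ι₀ g ι₀ = g⁻¹`; the lemma
below then gives `dim T^{ι₀} = dim T / 2 = 4`, which places `s*` on the `4`-dimensional fixed
component `W₀` (Cartan linearization; the other `ι₀`-fixed components have dimension `≤ 2`).

**Lemma.**  Let `V` be a finite-dimensional vector space over a field `F` with `2 ∈ Fˣ`, and let
`a, ι ∈ End(V)` with `ι² = 1`, `a` invertible with inverse `b`, `ι a ι = b` (`ι` inverts `a`), and
such that `a²` has no non-zero fixed vector.  Then `2 · dim V^ι = dim V`.
*Proof.*  `V = V₊ ⊕ V₋` (`ι`-eigenspaces; rank–nullity for `ι − 1`, whose image is `V₋`), and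
`φ = a − b` is injective (`φ v = 0 ⇒ a² v = v`) with `ι φ = −φ ι`, so `φ` embeds `V₊` in `V₋` and
`V₋` in `V₊`.  ∎  Corollary (representations): if `g` has odd order, `ι g ι = g⁻¹`, `ι² = 1` and
`V^g = 0`, then `2 · dim V^ι = dim V`.
-/

namespace Summit.Ventures.HodgeKum4

namespace Dihedral

open Module

variable {F V : Type*} [Field F] [AddCommGroup V] [Module F V]

/-- `ι a = b ι` from `ι a ι = b` and `ι² = 1`. -/
theorem iota_mul_eq (a b ι : Module.End F V) (hι : ι * ι = 1) (hconj : ι * a * ι = b) :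
    ι * a = b * ι := by
  calc ι * a = ι * a * (ι * ι) := by rw [hι, mul_one]
    _ = (ι * a * ι) * ι := by simp only [mul_assoc]
    _ = b * ι := by rw [hconj]

/-- `ι b = a ι` from `ι a ι = b` and `ι² = 1`. -/
theorem iota_mul_eq' (a b ι : Module.End F V) (hι : ι * ι = 1) (hconj : ι * a * ι = b) :
    ι * b = a * ι := by
  calc ι * b = ι * (ι * a * ι) := by rw [hconj]
    _ = (ι * ι) * a * ι := by simp only [mul_assoc]
    _ = a * ι := by rw [hι, one_mul]

/-- The image of `ι − 1` is the `(−1)`-eigenspace of the involution `ι` (`2` invertible). -/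
theorem range_sub_one_eq_ker_add_one (ι : Module.End F V) (hι : ι * ι = 1) (h2 : IsUnit (2 : F)) :
    LinearMap.range (ι - 1) = LinearMap.ker (ι + 1) := by
  ext v
  simp only [LinearMap.mem_range, LinearMap.mem_ker, LinearMap.sub_apply, LinearMap.add_apply,
    Module.End.one_apply]
  constructor
  · rintro ⟨w, rfl⟩
    have hw : ι (ι w) = w := by
      simpa [Module.End.mul_apply] using congrArg (fun f : Module.End F V => f w) hι
    rw [map_sub, hw]
    abel
  · intro hv
    obtain ⟨u, hu⟩ := h2
    refine ⟨(-((u⁻¹ : Fˣ) : F)) • v, ?_⟩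
    have hιv : ι v = -v := eq_neg_of_add_eq_zero_left hv
    have key : (-((u⁻¹ : Fˣ) : F)) • (-v) - (-((u⁻¹ : Fˣ) : F)) • v =
        ((u⁻¹ : Fˣ) : F) • ((2 : F) • v) := by
      rw [two_smul]
      simp only [smul_neg, neg_smul, neg_neg, sub_neg_eq_add, smul_add]
    rw [map_smul, hιv, key, smul_smul, ← hu, Units.inv_mul, one_smul]

/-- **Eigenspace decomposition of an involution** (`2` invertible):
`dim V^ι + dim V^{−ι} = dim V`. -/
theorem finrank_ker_sub_one_add [FiniteDimensional F V] (ι : Module.End F V) (hι : ι * ι = 1)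
    (h2 : IsUnit (2 : F)) :
    finrank F (LinearMap.ker (ι - 1)) + finrank F (LinearMap.ker (ι + 1)) = finrank F V := by
  rw [← range_sub_one_eq_ker_add_one ι hι h2, add_comm]
  exact LinearMap.finrank_range_add_finrank_ker (ι - 1)

/-- **The dihedral fixed-space lemma.**  `ι² = 1`, `a b = b a = 1`, `ι a ι = b`, `a²` without
non-zero fixed vectors, `2 ∈ Fˣ` ⇒ `2 · dim V^ι = dim V`. -/
theorem two_mul_finrank_ker_sub_one [FiniteDimensional F V] (h2 : IsUnit (2 : F))
    (a b ι : Module.End F V) (hab : a * b = 1) (hι : ι * ι = 1) (hconj : ι * a * ι = b)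
    (hfree : ∀ v, a (a v) = v → v = 0) :
    2 * finrank F (LinearMap.ker (ι - 1)) = finrank F V := by
  set φ : Module.End F V := a - b with hφdef
  have hιa : ι * a = b * ι := iota_mul_eq a b ι hι hconj
  have hιb : ι * b = a * ι := iota_mul_eq' a b ι hι hconj
  -- `ι φ = −φ ι`
  have hanti : ∀ v, ι (φ v) = -(φ (ι v)) := by
    intro v
    have h1 : ι (a v) = b (ι v) := by
      simpa [Module.End.mul_apply] using congrArg (fun f : Module.End F V => f v) hιa
    have h2' : ι (b v) = a (ι v) := by
      simpa [Module.End.mul_apply] using congrArg (fun f : Module.End F V => f v) hιb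
    simp only [hφdef, LinearMap.sub_apply, map_sub, h1, h2']
    abel
  -- `φ` is injective
  have hinj : ∀ v, φ v = 0 → v = 0 := by
    intro v hv
    apply hfree
    have hv' : a v = b v := sub_eq_zero.mp (by simpa [hφdef] using hv)
    rw [hv']
    simpa [Module.End.mul_apply] using congrArg (fun f : Module.End F V => f v) hab
  -- `φ` maps `V₊` into `V₋` and `V₋` into `V₊`
  have hpm : ∀ v ∈ LinearMap.ker (ι - 1), φ v ∈ LinearMap.ker (ι + 1) := by
    intro v hv
    simp only [LinearMap.mem_ker, LinearMap.sub_apply, Module.End.one_apply, sub_eq_zero] at hv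
    simp only [LinearMap.mem_ker, LinearMap.add_apply, Module.End.one_apply, hanti, hv,
      neg_add_cancel]
  have hmp : ∀ v ∈ LinearMap.ker (ι + 1), φ v ∈ LinearMap.ker (ι - 1) := by
    intro v hv
    simp only [LinearMap.mem_ker, LinearMap.add_apply, Module.End.one_apply] at hv
    have hv' : ι v = -v := eq_neg_of_add_eq_zero_left hv
    simp only [LinearMap.mem_ker, LinearMap.sub_apply, Module.End.one_apply, hanti, hv', map_neg,
      neg_neg, sub_self]
  -- the restricted maps
  let fpm : LinearMap.ker (ι - 1) →ₗ[F] LinearMap.ker (ι + 1) :=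
    (φ.domRestrict (LinearMap.ker (ι - 1))).codRestrict (LinearMap.ker (ι + 1))
      (fun v => hpm v.1 v.2)
  let fmp : LinearMap.ker (ι + 1) →ₗ[F] LinearMap.ker (ι - 1) :=
    (φ.domRestrict (LinearMap.ker (ι + 1))).codRestrict (LinearMap.ker (ι - 1))
      (fun v => hmp v.1 v.2)
  have hfpm : Function.Injective fpm := by
    intro v w hvw
    apply Subtype.ext
    have h := congrArg Subtype.val hvw
    simp only [fpm, LinearMap.codRestrict_apply, LinearMap.domRestrict_apply] at h
    have : φ (v.1 - w.1) = 0 := by rw [map_sub, h, sub_self]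
    exact sub_eq_zero.mp (hinj _ this)
  have hfmp : Function.Injective fmp := by
    intro v w hvw
    apply Subtype.ext
    have h := congrArg Subtype.val hvw
    simp only [fmp, LinearMap.codRestrict_apply, LinearMap.domRestrict_apply] at h
    have : φ (v.1 - w.1) = 0 := by rw [map_sub, h, sub_self]
    exact sub_eq_zero.mp (hinj _ this)
  have hle₁ := LinearMap.finrank_le_finrank_of_injective hfpm
  have hle₂ := LinearMap.finrank_le_finrank_of_injective hfmp
  have hsum := finrank_ker_sub_one_add ι hι h2
  omega

/-- In a representation, a vector fixed by `g²` is fixed by `g` when `g` has odd order. -/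
theorem apply_eq_self_of_sq {G : Type*} [Group G] (τ : Representation F G V) {g : G}
    (hodd : ∃ m : ℕ, g ^ (2 * m + 1) = 1) {v : V} (h : τ g (τ g v) = v) : τ g v = v := by
  obtain ⟨m, hm⟩ := hodd
  have h2 : τ (g ^ 2) v = v := by
    rw [pow_two, map_mul, Module.End.mul_apply, h]
  have hpow : ∀ j : ℕ, τ ((g ^ 2) ^ j) v = v := by
    intro j
    induction j with
    | zero => rw [pow_zero, map_one, Module.End.one_apply]
    | succ j ih => rw [pow_succ, map_mul, Module.End.mul_apply, h2, ih]
  have hkey : (g ^ 2) ^ (m + 1) = g := by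
    rw [← pow_mul, show 2 * (m + 1) = (2 * m + 1) + 1 by ring, pow_succ, hm, one_mul]
  have := hpow (m + 1)
  rwa [hkey] at this

/-- **Corollary (representations of a dihedral pair).**  If `τ` is a finite-dimensional
representation over a field with `2` invertible, `ι² = 1`, `ι g ι = g⁻¹`, `g` of odd order and
`V^g = 0`, then `2 · dim V^ι = dim V`. -/
theorem two_mul_finrank_fixed_eq {G : Type*} [Group G] [FiniteDimensional F V] (h2 : IsUnit (2 : F))
    (τ : Representation F G V) (g ι : G) (hι : ι * ι = 1) (hconj : ι * g * ι = g⁻¹)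
    (hodd : ∃ m : ℕ, g ^ (2 * m + 1) = 1) (hfix : ∀ v, τ g v = v → v = 0) :
    2 * finrank F (LinearMap.ker (τ ι - 1)) = finrank F V := by
  refine two_mul_finrank_ker_sub_one h2 (τ g) (τ g⁻¹) (τ ι) ?_ ?_ ?_ ?_
  · rw [← map_mul, mul_inv_cancel, map_one]
  · rw [← map_mul, hι, map_one]
  · rw [← map_mul, ← map_mul, hconj]
  · intro v hv
    exact hfix v (apply_eq_self_of_sq τ hodd hv)

end Dihedral

end Summit.Ventures.HodgeKum4
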